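import Literature.NumberTheory.EllipticCurves.PAdicMeasureTransformTranslationProofs
import Literature.NumberTheory.EllipticCurves.PAdicMeasureTransformBranches
import Literature.NumberTheory.EllipticCurves.PAdicLFunctionIntegralityAtTwoProofs
import HarnessLib

/-!
# The `ω^i`-BRANCHES of the transform of a translated distribution (and the sign branch at `p = 2`):
# `η_z^i · lim_n Σ_ζ ζ^i Σ_s ν(z·ζγˢ) C(s,k) = Σ_{j≤k} (−c choose k−j) · lim_n Σ_ζ ζ^i Σ_s ν(ζγˢ) C(s,j)` (PROOFS ONLY)

Topic `Literature/NumberTheory/EllipticCurves`; THEOREMS ONLY (no definition, no named fact). The tree's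
`tendsto_riemannSum_translate` (`PAdicMeasureTransformTranslationProofs`; Matsuno 2000 Lemma 3.3, Mazur–Tate–Teitelbaum §I.13) computes the
transform of the translate `x ↦ z x` of a bounded distribution `ν` on `ℤ_p` for the UNWEIGHTED Riemann sums `Σ_η Σ_s ν(ηγˢ)C(s,k)` (the
`ω⁰`-branch). The `ω^i`-BRANCHES carry the weight `ω(x)^i = ζ^i` (`ζ` the Teichmüller part of the class). This file reduces them to
the unweighted lemma through the tree's twisted family `branchTwist i ν = ω^i·ν` (`PAdicMeasureTransformBranches`: again a bounded
distribution; its plain Riemann sums are the weighted ones of `ν`, `weightedRiemannSum_eq`): the translate of `ω^i ν` by `z = η_z γ^c`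
has Riemann sums `ω(z)^i = η_z^i` times the weighted translated sums of `ν` (`ω` is multiplicative: `teichReduce` is a monoid map), so

* `tendsto_weightedRiemannSum_translate` — for a bounded distribution `ν` on `ℤ_p`, weighted sums `RS(k,n) = Σ_ζ ζ^i Σ_s ν(ζγˢ)C(s,k)`
  and translated weighted sums `RS_z(k,n) = Σ_ζ ζ^i Σ_s ν(z_n·ζγˢ)C(s,k)` (`z_n = η_z γ^{c mod pⁿ}`):
  `η_z^i · RS_z(k,·) → Σ_{j≤k} (−c choose k−j) · lim_n RS(j,n)`;
* `tendsto_branchRiemannSum_translate_two` — `p = 2`, `i = 1` (`η_z = ±1 = η_z⁻¹`): `B_z(k,·) → η_z · Σ_{j≤k} (−c choose k−j) · lim_n B(j,n)`.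

This is the analytic input G3 of the odd-class Birch transport of crux stmt-BirchSwinnertonDyer-20368 road (C) (memo
`Cruxes/SplitBadTwoRankOneOfFacts/PERIOD-CANCELS-w8g24.md` §8): with `ν = Σ_b χ(b)μ^∓_{f,α,m}(· × b)` and `z = m` it turns the measure-level
Birch lemma for `μ⁻_{f⊗χ}` into `L⁻₂(f⊗χ, χ(2)α, ω, T) = C(c·χ₄(m))·(1+T)^{−ℓ_m}·L^∓₂(f, m, α, ωχ, T)`.

References: K. Matsuno, J. Number Theory 84 (2000) Lemma 3.3 [Matsuno2000]; B. Mazur, J. Tate, J. Teitelbaum, Invent. Math. 84 (1986)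
§I.13 (p = 2: `Δ = {±1}`, `γ = 5`) [MazurTateTeitelbaum1986Invent].
-/

noncomputable section

open Filter Topology

namespace Literature.NumberTheory.EllipticCurves

section BranchTranslation

/-- The `2`-adic roots of unity indexing the Riemann sums at `p = 2` are `±1` (the same statement is proved Summits-side as
`Summit.BirchSwinnertonDyer.Rank1Residual.F1Sign2.coe_rootsOfUnity_torsionOrder_two`, not importable under `Literature`).
[cite: MazurTateTeitelbaum1986Invent, §I.13] -/
theorem coe_rootsOfUnity_torsionOrder_two_eq_or (ξ : rootsOfUnity (torsionOrder 2) ℤ_[2]) :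
    ((ξ : ℤ_[2]ˣ) : ℤ_[2]) = 1 ∨ ((ξ : ℤ_[2]ˣ) : ℤ_[2]) = -1 := by
  obtain ⟨u, hu⟩ := ξ
  have h : u ^ torsionOrder 2 = 1 := (mem_rootsOfUnity _ _).mp hu
  rw [torsionOrder_two] at h
  have h' : ((u : ℤ_[2])) ^ 2 = 1 := by
    rw [← Units.val_pow_eq_pow_val, h, Units.val_one]
  exact sq_eq_one_iff.mp h'

/-- **The `ω^i`-weighted transform of a translated distribution.** Let `ν` be a distribution on `ℤ_p` (fibre relation at every
level, `‖ν‖ ≤ C`), `RS(k,n) = Σ_ζ ζ^i·Σ_{s mod pⁿ} ν(ζγˢ + p^{n+e₀}ℤ_p)·C(s,k)` its `ω^i`-weighted Riemann sums and `RS_z(k,n)` those of its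
translate by the compatible classes `z_n = η_z·γ^{c mod pⁿ}` (`η_z ∈ μ`, `c ∈ ℤ_p`). Then
`η_z^i · RS_z(k,n) → Σ_{j ≤ k} (−c choose k−j) · lim_n RS(j,n)`: the weighted sums are the plain sums of `ω^i ν`
(`weightedRiemannSum_eq`), whose translate by `z` has plain sums `ω(z)^i·RS_z = η_z^i·RS_z` (`ω(z·ζγˢ) = η_z·ζ`), and
`tendsto_riemannSum_translate` applies to the bounded distribution `ω^i ν`.
[cite: Matsuno2000, Lemma 3.3 (pp. 87–88)] [cite: MazurTateTeitelbaum1986Invent, §I.13 (pp. 18–19)] -/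
theorem tendsto_weightedRiemannSum_translate {p : ℕ} [Fact p.Prime] {ν : (n : ℕ) → ZMod (p ^ n) → ℚ_[p]}
    (hdist : ∀ (n : ℕ) (a : ZMod (p ^ n)),
      ∑ b ∈ Finset.univ.filter (fun b : ZMod (p ^ (n + 1)) ↦
        ZMod.castHom (pow_dvd_pow p n.le_succ) (ZMod (p ^ n)) b = a), ν (n + 1) b = ν n a)
    {C : ℝ} (hC : ∀ (n : ℕ) (a : ZMod (p ^ n)), ‖ν n a‖ ≤ C) {i : ℕ}
    {RS RSz : ℕ → ℕ → ℚ_[p]}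
    (hRS : ∀ k n : ℕ, RS k n =
      ∑ᶠ ζ : rootsOfUnity (torsionOrder p) ℤ_[p], ∑ s : ZMod (p ^ n),
        (((ζ : ℤ_[p]ˣ) : ℤ_[p]) : ℚ_[p]) ^ i *
          ν (n + cyclotomicExponent p)
            (PadicInt.toZModPow (n + cyclotomicExponent p) ((ζ : ℤ_[p]ˣ) : ℤ_[p]) *
              (cyclotomicGenerator p : ZMod (p ^ (n + cyclotomicExponent p))) ^ s.val) *
          ((s.val.choose k : ℕ) : ℚ_[p]))
    {ηz : rootsOfUnity (torsionOrder p) ℤ_[p]} {c : ℤ_[p]}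
    (hRSz : ∀ k n : ℕ, RSz k n =
      ∑ᶠ ζ : rootsOfUnity (torsionOrder p) ℤ_[p], ∑ s : ZMod (p ^ n),
        (((ζ : ℤ_[p]ˣ) : ℤ_[p]) : ℚ_[p]) ^ i *
          ν (n + cyclotomicExponent p)
            ((PadicInt.toZModPow (n + cyclotomicExponent p) ((ηz : ℤ_[p]ˣ) : ℤ_[p]) *
              (cyclotomicGenerator p : ZMod (p ^ (n + cyclotomicExponent p))) ^ (PadicInt.toZModPow n c).val) *
            (PadicInt.toZModPow (n + cyclotomicExponent p) ((ζ : ℤ_[p]ˣ) : ℤ_[p]) *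
              (cyclotomicGenerator p : ZMod (p ^ (n + cyclotomicExponent p))) ^ s.val)) *
          ((s.val.choose k : ℕ) : ℚ_[p]))
    (k : ℕ) :
    Tendsto (fun n ↦ (((ηz : ℤ_[p]ˣ) : ℤ_[p]) : ℚ_[p]) ^ i * RSz k n) atTop
      (𝓝 (∑ j ∈ Finset.range (k + 1),
        algebraMap ℤ_[p] ℚ_[p] (Ring.choose (-c) (k - j)) * limUnder atTop (fun n ↦ RS j n))) := by
  classical
  haveI := neZero_torsionOrder p
  haveI := Fintype.ofFinite (rootsOfUnity (torsionOrder p) ℤ_[p])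
  -- the weighted sums of `ν` are the plain sums of `ω^i ν`
  have hRS' := fun k n ↦ weightedRiemannSum_eq hRS hdist k n
  -- the translated weighted sums of `ν`, times `η_z^i`, are the translated plain sums of `ω^i ν`
  have hRSz' : ∀ k n : ℕ, (((ηz : ℤ_[p]ˣ) : ℤ_[p]) : ℚ_[p]) ^ i * RSz k n =
      ∑ᶠ ζ : rootsOfUnity (torsionOrder p) ℤ_[p], ∑ s : ZMod (p ^ n),
        branchTwist i ν (n + cyclotomicExponent p)
            ((PadicInt.toZModPow (n + cyclotomicExponent p) ((ηz : ℤ_[p]ˣ) : ℤ_[p]) *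
              (cyclotomicGenerator p : ZMod (p ^ (n + cyclotomicExponent p))) ^ (PadicInt.toZModPow n c).val) *
            (PadicInt.toZModPow (n + cyclotomicExponent p) ((ζ : ℤ_[p]ˣ) : ℤ_[p]) *
              (cyclotomicGenerator p : ZMod (p ^ (n + cyclotomicExponent p))) ^ s.val)) *
          ((s.val.choose k : ℕ) : ℚ_[p]) := by
    intro k n
    have hle : cyclotomicExponent p ≤ n + cyclotomicExponent p := Nat.le_add_left _ _
    rw [hRSz, finsum_eq_sum_of_fintype, finsum_eq_sum_of_fintype, Finset.mul_sum]
    refine Finset.sum_congr rfl fun ζ _ ↦ ?_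
    rw [Finset.mul_sum]
    refine Finset.sum_congr rfl fun s _ ↦ ?_
    rw [branchTwist_apply_of_distribution hdist i hle]
    have hred : ZMod.castHom (pow_dvd_pow p hle) (ZMod (p ^ cyclotomicExponent p))
        ((PadicInt.toZModPow (n + cyclotomicExponent p) ((ηz : ℤ_[p]ˣ) : ℤ_[p]) *
            (cyclotomicGenerator p : ZMod (p ^ (n + cyclotomicExponent p))) ^ (PadicInt.toZModPow n c).val) *
          (PadicInt.toZModPow (n + cyclotomicExponent p) ((ζ : ℤ_[p]ˣ) : ℤ_[p]) *
            (cyclotomicGenerator p : ZMod (p ^ (n + cyclotomicExponent p))) ^ s.val)) =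
        ((teichReduce p (ηz * ζ) : (ZMod (p ^ cyclotomicExponent p))ˣ) : ZMod (p ^ cyclotomicExponent p)) := by
      simp only [map_mul, map_pow, map_natCast, cyclotomicGenerator_cast_cyclotomicExponent, one_pow, mul_one,
        ZMod.castHom_apply, PadicInt.cast_toZModPow _ _ hle, val_teichReduce, Subgroup.coe_mul, Units.val_mul]
    rw [hred, teichWeight_units, teichRep_teichReduce]
    simp only [Subgroup.coe_mul, Units.val_mul, PadicInt.coe_mul, mul_pow]
    ring
  exact tendsto_riemannSum_translate (branchTwist_distribution hdist i) (norm_branchTwist_le hC i) hRS' hRSz' k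

/-- **The `ω`-branch of the transform of a translated distribution at `p = 2`.** Let `ν` be a distribution on `ℤ₂` with the fibre
relation at every level and `‖ν‖ ≤ C`; let `B(k,n) = Σ_ζ ζ·Σ_{s mod 2ⁿ} ν(ζγˢ + 2^{n+2}ℤ₂)·C(s,k)` be its `ω`-BRANCH Riemann sums and
`B_z(k,n)` those of its translate by the compatible classes `z_n = η_z·γ^{c mod 2ⁿ}` (`η_z = ±1`, `c ∈ ℤ₂`). Then `B_z(k,·)` converges and
`lim_n B_z(k,n) = η_z · Σ_{i ≤ k} (−c choose k−i) · lim_n B(i,n)` — the `k`-th coefficient of `ω(z)·(1+T)^{−c}·Σ_i (lim B(i,·)) Tⁱ`.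
Proof: `tendsto_weightedRiemannSum_translate` with `i = 1`, divided by `η_z = η_z⁻¹ = ±1`.
[cite: Matsuno2000, Lemma 3.3 (pp. 87–88)] [cite: MazurTateTeitelbaum1986Invent, §I.13 (pp. 18–19)] -/
theorem tendsto_branchRiemannSum_translate_two {ν : (n : ℕ) → ZMod (2 ^ n) → ℚ_[2]}
    (hdist : ∀ (n : ℕ) (a : ZMod (2 ^ n)),
      ∑ b ∈ Finset.univ.filter (fun b : ZMod (2 ^ (n + 1)) ↦
        ZMod.castHom (pow_dvd_pow 2 n.le_succ) (ZMod (2 ^ n)) b = a), ν (n + 1) b = ν n a)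
    {C : ℝ} (hC : ∀ (n : ℕ) (a : ZMod (2 ^ n)), ‖ν n a‖ ≤ C)
    {B Bz : ℕ → ℕ → ℚ_[2]}
    (hB : ∀ k n : ℕ, B k n =
      ∑ᶠ ζ : rootsOfUnity (torsionOrder 2) ℤ_[2], ∑ s : ZMod (2 ^ n),
        (((ζ : ℤ_[2]ˣ) : ℤ_[2]) : ℚ_[2]) *
          ν (n + cyclotomicExponent 2)
            (PadicInt.toZModPow (n + cyclotomicExponent 2) ((ζ : ℤ_[2]ˣ) : ℤ_[2]) *
              (cyclotomicGenerator 2 : ZMod (2 ^ (n + cyclotomicExponent 2))) ^ s.val) *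
          ((s.val.choose k : ℕ) : ℚ_[2]))
    {ηz : rootsOfUnity (torsionOrder 2) ℤ_[2]} {c : ℤ_[2]}
    (hBz : ∀ k n : ℕ, Bz k n =
      ∑ᶠ ζ : rootsOfUnity (torsionOrder 2) ℤ_[2], ∑ s : ZMod (2 ^ n),
        (((ζ : ℤ_[2]ˣ) : ℤ_[2]) : ℚ_[2]) *
          ν (n + cyclotomicExponent 2)
            ((PadicInt.toZModPow (n + cyclotomicExponent 2) ((ηz : ℤ_[2]ˣ) : ℤ_[2]) *
              (cyclotomicGenerator 2 : ZMod (2 ^ (n + cyclotomicExponent 2))) ^ (PadicInt.toZModPow n c).val) *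
            (PadicInt.toZModPow (n + cyclotomicExponent 2) ((ζ : ℤ_[2]ˣ) : ℤ_[2]) *
              (cyclotomicGenerator 2 : ZMod (2 ^ (n + cyclotomicExponent 2))) ^ s.val)) *
          ((s.val.choose k : ℕ) : ℚ_[2]))
    (k : ℕ) :
    Tendsto (fun n ↦ Bz k n) atTop
      (𝓝 ((((ηz : ℤ_[2]ˣ) : ℤ_[2]) : ℚ_[2]) * ∑ i ∈ Finset.range (k + 1),
        algebraMap ℤ_[2] ℚ_[2] (Ring.choose (-c) (k - i)) * limUnder atTop (fun n ↦ B i n))) := by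
  have hB1 : ∀ k n : ℕ, B k n =
      ∑ᶠ ζ : rootsOfUnity (torsionOrder 2) ℤ_[2], ∑ s : ZMod (2 ^ n),
        (((ζ : ℤ_[2]ˣ) : ℤ_[2]) : ℚ_[2]) ^ 1 *
          ν (n + cyclotomicExponent 2)
            (PadicInt.toZModPow (n + cyclotomicExponent 2) ((ζ : ℤ_[2]ˣ) : ℤ_[2]) *
              (cyclotomicGenerator 2 : ZMod (2 ^ (n + cyclotomicExponent 2))) ^ s.val) *
          ((s.val.choose k : ℕ) : ℚ_[2]) := fun k n ↦ by
    simp only [pow_one]; exact hB k n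
  have hBz1 : ∀ k n : ℕ, Bz k n =
      ∑ᶠ ζ : rootsOfUnity (torsionOrder 2) ℤ_[2], ∑ s : ZMod (2 ^ n),
        (((ζ : ℤ_[2]ˣ) : ℤ_[2]) : ℚ_[2]) ^ 1 *
          ν (n + cyclotomicExponent 2)
            ((PadicInt.toZModPow (n + cyclotomicExponent 2) ((ηz : ℤ_[2]ˣ) : ℤ_[2]) *
              (cyclotomicGenerator 2 : ZMod (2 ^ (n + cyclotomicExponent 2))) ^ (PadicInt.toZModPow n c).val) *
            (PadicInt.toZModPow (n + cyclotomicExponent 2) ((ζ : ℤ_[2]ˣ) : ℤ_[2]) *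
              (cyclotomicGenerator 2 : ZMod (2 ^ (n + cyclotomicExponent 2))) ^ s.val)) *
          ((s.val.choose k : ℕ) : ℚ_[2]) := fun k n ↦ by
    simp only [pow_one]; exact hBz k n
  have hlim := tendsto_weightedRiemannSum_translate hdist hC hB1 hBz1 k
  simp only [pow_one] at hlim
  -- divide by `η_z = ±1`
  have hηz2 : ((((ηz : ℤ_[2]ˣ) : ℤ_[2]) : ℚ_[2])) * (((ηz : ℤ_[2]ˣ) : ℤ_[2]) : ℚ_[2]) = 1 := by
    rcases coe_rootsOfUnity_torsionOrder_two_eq_or ηz with h | h <;> simp [h]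
  refine ((hlim.const_mul ((((ηz : ℤ_[2]ˣ) : ℤ_[2]) : ℚ_[2]))).congr fun n ↦ ?_)
  show (((ηz : ℤ_[2]ˣ) : ℤ_[2]) : ℚ_[2]) * ((((ηz : ℤ_[2]ˣ) : ℤ_[2]) : ℚ_[2]) * Bz k n) = Bz k n
  rw [← mul_assoc, hηz2, one_mul]

end BranchTranslation

end Literature.NumberTheory.EllipticCurves

end
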